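import Summits.BirchSwinnertonDyer.BirchSwinnertonDyer.Theorems.Rank2Observatory2DescSignature
import Literature.NumberTheory.EllipticCurves.TwoDescentOneRootH1Injective
import HarnessLib

/-!
# BirchSwinnertonDyer / ShaPrimaryTransfer — crux `FiniteShaComponentTransfer` (stmt-BirchSwinnertonDyer-22356):
# SEL2CUBIC row wrapper — `Sel⁽²⁾(E/ℚ) ↪ Kˣ/Kˣ²` in the exact shape of a kernel `2`-descent certificate row

Helper file of prover seat `bsd-line-spt-p1` g28 (`--supports stmt-22356 --as helper`), ROUTE-INDEPENDENT (no `Theses`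
import). THEOREMS ONLY. HONEST FRAMING: nothing here proves T, O, any `Ш[2] = 0`, or BSD in rank `≥ 2`.

A row of the cell's kernel `2`-descent instrument (`Rank2Observatory…TwoDescRankTwo`, `…TwoDescClR3Rows…`) carries: a
short model `E = ⟨0, A, 0, B, C⟩` of the census curve, the cubic field `K = CubicField a b c = ℚ[X]/(X³ + aX² + bX + c)`
of the cell (`Rank2Observatory2DescSignature`), an element `θ ∈ K` with `F(θ) = 0`, `F = X³ + AX² + BX + C`
(`aeval_theta`), and `Irreducible (MonicCubic.polyQ A B C)` (`irreducible_F`). This file turns exactly these data into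
the hypotheses of the generic cohomological theorem `WeierstrassCurve.oneRootDescentH1_injective` (Literature
`TwoDescentOneRootH1Injective`, this seat) and concludes, uniformly for every row:

* `isTwoTorsionX_of_aeval` — `F(θ) = 0 ⇒ Ψ₂(E_K)(θ) = 0` (`Ψ₂ = 4F` for the model `⟨0, A, 0, B, C⟩`);
* `irreducible_twoDivision_of_irreducible_polyQ` — the monic `2`-division cubic of `E` IS `MonicCubic.polyQ A B C`;
* **`oneRootDescentH1_injective_row`** — the one-root descent map `H¹(ℚ, E[2]) → H¹(K, E_K[2]) → H¹(K, μ₂)` is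
  injective; **`selmerGroup_two_injOn_row`** — `Sel⁽²⁾(E/ℚ)` embeds into `H¹(K, μ₂) ≃ Kˣ/Kˣ²`.

This is the uniform entry point for the successor steps S4–S6 of the memo SEL2CUBIC-g28 (local conditions of Selmer
classes and Selmer-soundness of the certificate checker ⇒ `#Sel⁽²⁾ < 2^(r+1)` ⇒ `Ш(E)[2] = 0`). BSD is NOT proved.

References: [cite: Cassels1991LecturesEllipticCurves, §15 Lemma 2]; [cite: CremonaAlgorithms1997, §3.6];
[cite: SilvermanAEC2009, Thm. X.1.1, Prop. X.1.4].
-/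

-- D-0017: single-problem summit, so `Summit.BirchSwinnertonDyer.BirchSwinnertonDyer.…` repeats a namespace BY DESIGN.
set_option linter.dupNamespace false

noncomputable section

open scoped Classical NumberField

open Literature.NumberTheory.NumberFields Polynomial Module NumberField
open Literature.NumberTheory.EllipticCurves Literature.NumberTheory.GaloisRepresentations

namespace Summit.BirchSwinnertonDyer.BirchSwinnertonDyer.Theorems.ShaPrimaryTransferSelmerCubicRow

open Summit.BirchSwinnertonDyer.BirchSwinnertonDyer.Rank2Observatory
open TwoDescCubic

variable {A B C : ℤ} {a b c : ℤ} [Fact (Irreducible (MonicCubic.polyQ a b c))] {θ : CubicField a b c}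

omit [Fact (Irreducible (MonicCubic.polyQ a b c))] in
/-- For the short model `E = ⟨0, A, 0, B, C⟩`: `b₂ = 4A`, `b₄ = 2B`, `b₆ = 4C`. [cite: CremonaAlgorithms1997, §3.6] -/
theorem b_eq_of_model : (⟨0, (A : ℚ), 0, (B : ℚ), (C : ℚ)⟩ : WeierstrassCurve ℚ).b₂ = 4 * A ∧
    (⟨0, (A : ℚ), 0, (B : ℚ), (C : ℚ)⟩ : WeierstrassCurve ℚ).b₄ = 2 * B ∧
    (⟨0, (A : ℚ), 0, (B : ℚ), (C : ℚ)⟩ : WeierstrassCurve ℚ).b₆ = 4 * C := by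
  refine ⟨?_, ?_, ?_⟩
  · simp only [WeierstrassCurve.b₂]; ring
  · simp only [WeierstrassCurve.b₄]; ring
  · simp only [WeierstrassCurve.b₆]; ring

/-- **`F(θ) = 0 ⇒ θ` is a root of `Ψ₂(E_K) = 4F`** for `E = ⟨0, A, 0, B, C⟩`, `F = X³ + AX² + BX + C`.
[cite: Cassels1991LecturesEllipticCurves, §15 (F(Θ) = 0)] -/
theorem isTwoTorsionX_of_aeval (hθ : aeval θ (MonicCubic.poly A B C) = 0) :
    ((⟨0, (A : ℚ), 0, (B : ℚ), (C : ℚ)⟩ : WeierstrassCurve ℚ).baseChange (CubicField a b c)).toAffine.IsTwoTorsionX θ := by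
  refine ⟨?_⟩
  have h := MonicCubic.theta_rel hθ
  have hb2 : ((⟨0, (A : ℚ), 0, (B : ℚ), (C : ℚ)⟩ : WeierstrassCurve ℚ).baseChange (CubicField a b c)).toAffine.b₂ =
      algebraMap ℚ (CubicField a b c) (⟨0, (A : ℚ), 0, (B : ℚ), (C : ℚ)⟩ : WeierstrassCurve ℚ).b₂ :=
    WeierstrassCurve.map_b₂ _ _
  have hb4 : ((⟨0, (A : ℚ), 0, (B : ℚ), (C : ℚ)⟩ : WeierstrassCurve ℚ).baseChange (CubicField a b c)).toAffine.b₄ =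
      algebraMap ℚ (CubicField a b c) (⟨0, (A : ℚ), 0, (B : ℚ), (C : ℚ)⟩ : WeierstrassCurve ℚ).b₄ :=
    WeierstrassCurve.map_b₄ _ _
  have hb6 : ((⟨0, (A : ℚ), 0, (B : ℚ), (C : ℚ)⟩ : WeierstrassCurve ℚ).baseChange (CubicField a b c)).toAffine.b₆ =
      algebraMap ℚ (CubicField a b c) (⟨0, (A : ℚ), 0, (B : ℚ), (C : ℚ)⟩ : WeierstrassCurve ℚ).b₆ :=
    WeierstrassCurve.map_b₆ _ _
  rw [hb2, hb4, hb6, b_eq_of_model.1, b_eq_of_model.2.1, b_eq_of_model.2.2]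
  simp only [map_mul, map_ofNat, map_intCast]
  linear_combination (4 : CubicField a b c) * h

omit [Fact (Irreducible (MonicCubic.polyQ a b c))] in
/-- **The monic `2`-division cubic of `E = ⟨0, A, 0, B, C⟩` is `MonicCubic.polyQ A B C`**; hence it is irreducible when
the certificate says so. [cite: Cassels1991LecturesEllipticCurves, §15 (F irreducible)] -/
theorem irreducible_twoDivision_of_irreducible_polyQ (hirr : Irreducible (MonicCubic.polyQ A B C)) :
    Irreducible (X ^ 3 + Polynomial.C ((⟨0, (A : ℚ), 0, (B : ℚ), (C : ℚ)⟩ : WeierstrassCurve ℚ).b₂ / 4) * X ^ 2 +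
      Polynomial.C ((⟨0, (A : ℚ), 0, (B : ℚ), (C : ℚ)⟩ : WeierstrassCurve ℚ).b₄ / 2) * X +
      Polynomial.C ((⟨0, (A : ℚ), 0, (B : ℚ), (C : ℚ)⟩ : WeierstrassCurve ℚ).b₆ / 4) : ℚ[X]) := by
  have h4A : ((⟨0, (A : ℚ), 0, (B : ℚ), (C : ℚ)⟩ : WeierstrassCurve ℚ).b₂ / 4 : ℚ) = A := by
    rw [b_eq_of_model.1]; ring
  have h2B : ((⟨0, (A : ℚ), 0, (B : ℚ), (C : ℚ)⟩ : WeierstrassCurve ℚ).b₄ / 2 : ℚ) = B := by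
    rw [b_eq_of_model.2.1]; ring
  have h4C : ((⟨0, (A : ℚ), 0, (B : ℚ), (C : ℚ)⟩ : WeierstrassCurve ℚ).b₆ / 4 : ℚ) = C := by
    rw [b_eq_of_model.2.2]; ring
  rw [h4A, h2B, h4C, ← MonicCubic.polyQ_eq]
  exact hirr

/-- `E_K` is elliptic when `E` is. [cite: SilvermanAEC2009, III.§1] -/
theorem isElliptic_baseChange_row [hE : (⟨0, (A : ℚ), 0, (B : ℚ), (C : ℚ)⟩ : WeierstrassCurve ℚ).IsElliptic] :
    ((⟨0, (A : ℚ), 0, (B : ℚ), (C : ℚ)⟩ : WeierstrassCurve ℚ).baseChange (CubicField a b c)).IsElliptic :=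
  WeierstrassCurve.isElliptic_baseChange _ (CubicField a b c)

/-- **SEL2CUBIC, row form: the one-root (Cassels) descent map `H¹(ℚ, E[2]) → H¹(K, μ₂)` of a certificate row is
injective** (`E = ⟨0, A, 0, B, C⟩` elliptic, `K = CubicField a b c`, `F(θ) = 0`, `F = X³ + AX² + BX + C` irreducible).
[cite: Cassels1991LecturesEllipticCurves, §15 Lemma 2] -/
theorem oneRootDescentH1_injective_row [hE : (⟨0, (A : ℚ), 0, (B : ℚ), (C : ℚ)⟩ : WeierstrassCurve ℚ).IsElliptic]
    (hθ : aeval θ (MonicCubic.poly A B C) = 0) (hirr : Irreducible (MonicCubic.polyQ A B C)) :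
    haveI := isElliptic_baseChange_row (A := A) (B := B) (C := C) (a := a) (b := b) (c := c);
    Function.Injective ((⟨0, (A : ℚ), 0, (B : ℚ), (C : ℚ)⟩ : WeierstrassCurve ℚ).oneRootDescentH1 (CubicField a b c)
      (isTwoTorsionX_of_aeval hθ)) := by
  haveI := isElliptic_baseChange_row (A := A) (B := B) (C := C) (a := a) (b := b) (c := c)
  exact WeierstrassCurve.oneRootDescentH1_injective _ (irreducible_twoDivision_of_irreducible_polyQ hirr)
    (CubicField.finrank_eq a b c) (isTwoTorsionX_of_aeval hθ)

/-- **Row form of the `2`-Selmer embedding**: `Sel⁽²⁾(E/ℚ)` embeds into `H¹(K, μ₂) ≃ Kˣ/Kˣ²` for every certificate row.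
[cite: Cassels1991LecturesEllipticCurves, §15 Lemma 2] -/
theorem selmerGroup_two_injOn_row [hE : (⟨0, (A : ℚ), 0, (B : ℚ), (C : ℚ)⟩ : WeierstrassCurve ℚ).IsElliptic]
    (hθ : aeval θ (MonicCubic.poly A B C) = 0) (hirr : Irreducible (MonicCubic.polyQ A B C)) :
    haveI := isElliptic_baseChange_row (A := A) (B := B) (C := C) (a := a) (b := b) (c := c);
    Set.InjOn ((⟨0, (A : ℚ), 0, (B : ℚ), (C : ℚ)⟩ : WeierstrassCurve ℚ).oneRootDescentH1 (CubicField a b c)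
        (isTwoTorsionX_of_aeval hθ))
      (WeierstrassCurve.selmerGroup (⟨0, (A : ℚ), 0, (B : ℚ), (C : ℚ)⟩ : WeierstrassCurve ℚ) 2 :
        Set (WeierstrassCurve.galH1Torsion (⟨0, (A : ℚ), 0, (B : ℚ), (C : ℚ)⟩ : WeierstrassCurve ℚ) 2)) :=
  (oneRootDescentH1_injective_row hθ hirr).injOn

/-- **Row form, read in `Kˣ/Kˣ²`**: composed with Kummer theory the `2`-Selmer classes of `E` have pairwise distinct
Cassels values in `Kˣ/Kˣ²`. [cite: Cassels1991LecturesEllipticCurves, §15 (μ into ℚ[Θ]*/ℚ[Θ]*²)] -/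
theorem kummer_oneRootDescentH1_injective_row [hE : (⟨0, (A : ℚ), 0, (B : ℚ), (C : ℚ)⟩ : WeierstrassCurve ℚ).IsElliptic]
    (hθ : aeval θ (MonicCubic.poly A B C) = 0) (hirr : Irreducible (MonicCubic.polyQ A B C)) :
    haveI := isElliptic_baseChange_row (A := A) (B := B) (C := C) (a := a) (b := b) (c := c);
    Function.Injective (fun x : WeierstrassCurve.galH1Torsion (⟨0, (A : ℚ), 0, (B : ℚ), (C : ℚ)⟩ : WeierstrassCurve ℚ) 2 =>
      kummerEquiv (CubicField a b c) 2
        (((⟨0, (A : ℚ), 0, (B : ℚ), (C : ℚ)⟩ : WeierstrassCurve ℚ).oneRootDescentH1 (CubicField a b c)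
          (isTwoTorsionX_of_aeval hθ)) x)) :=
  (kummerEquiv (CubicField a b c) 2).injective.comp (oneRootDescentH1_injective_row hθ hirr)

end Summit.BirchSwinnertonDyer.BirchSwinnertonDyer.Theorems.ShaPrimaryTransferSelmerCubicRow

end
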